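import Mathlib
import Literature.NumberTheory.LFunctions.Zhang2022.Section17NuOneStarMajorant
import HarnessLib

/-!
# Zhang (2022) §17: `ν⁻(n) = Σ_{d∣n} μ(d)χ(d) = ∏_{p∣n}(1 − χ(p))` depends on the radical only;
# `|ν⁻(mn)| ≤ |ν⁻(m)|·2^{ω(n)}`

Topic `Literature/NumberTheory/LFunctions/Zhang2022` (Landau–Siegel audit tree; verdict-neutral).
Y. Zhang, *Discrete mean estimates and the Landau–Siegel zero*, arXiv:2211.02515v1 (2022)
[Zhang2022LandauSiegel] — **an unrefereed manuscript under adjudication**; nothing here asserts or denies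
its Theorems 1–2. §17 p. 97–98 (u014, u021) with §3 p. 6 (`υ = μ ∗ μχ`, so `υ ∗ 1 ∗ 1 = μχ ∗ 1 =: ν⁻`,
the main part of `ν₁*` below `D⁴`, `Section17NuOneStarMajorant.norm_nuOneStar_le`). Tools for the
§17.u021 remainder `R₁` (WP16 leaf h17_9; the lane's route RT16-int-5, piece P1 of MEMO-R1-window §2(i):
"`|ν⁻(l₂m₂)| ≤ |ν⁻(l₂)|·2^{ω(m₂)}` (depends on rad only)"):

* `sum_divisors_moebius_chi_eq_prod` — `Σ_{d∣n} μ(d)χ(d) = ∏_{p∣n} (1 − χ(p))` (`n ≥ 1`);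
* `norm_nuMinus_eq_prod` — `|ν⁻(n)| = ∏_{p∣n} |1 − χ(p)|`;
* `norm_nuMinus_mul_le(_tau)` — `|ν⁻(mn)| ≤ |ν⁻(m)|·2^{#primeFactors n} ≤ |ν⁻(m)|·τ₂(n)` (each new prime
  contributes `|1−χ(p)| ≤ 2`; no coprimality needed).

Theorems only (no definitions, no named facts); axioms standard. WHAT THIS IS NOT: a bound for `R₁`;
any claim about Theorems 1–2 of the source or about Landau–Siegel zeros.

## References

* Y. Zhang, arXiv:2211.02515v1 (2022), §3 p. 6, §17 pp. 97–98. [cite: Zhang2022LandauSiegel, §17 u021 p.98]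
-/

noncomputable section

open Complex Finset ArithmeticFunction
open Literature.NumberTheory.LFunctions.Zhang2022.Skeleton

namespace Literature.NumberTheory.LFunctions.Zhang2022.Phi3Eval

variable {D : ℕ} (χ : DirichletCharacter ℂ D)

/-- The divisor sum `Σ_{d∣n} μ(d)χ(d)` is the arithmetic function `(μ·χ) ∗ ζ` at `n`.
[cite: Zhang2022LandauSiegel, §3 p.6] -/
theorem sum_divisors_moebius_chi_eq_AF (n : ℕ) :
    ∑ d ∈ n.divisors, (ArithmeticFunction.moebius d : ℂ) * χ (d : ZMod D) =
      (((ArithmeticFunction.moebius : ArithmeticFunction ℂ).pmul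
        (toArithmeticFunction (fun k : ℕ => χ (k : ZMod D)))) *
          (ArithmeticFunction.zeta : ArithmeticFunction ℂ)) n := by
  rw [ArithmeticFunction.coe_mul_zeta_apply]
  refine Finset.sum_congr rfl fun d hd => ?_
  have hd0 : d ≠ 0 := (Nat.pos_of_mem_divisors hd).ne'
  simp [ArithmeticFunction.pmul_apply, toArithmeticFunction, hd0]

/-- `(μχ ∗ 1)(p^{k+1}) = 1 − χ(p)`. [cite: Zhang2022LandauSiegel, §3 p.6] -/
theorem moebiusChi_mul_zeta_prime_pow_succ {p : ℕ} (hp : p.Prime) (k : ℕ) :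
    (((ArithmeticFunction.moebius : ArithmeticFunction ℂ).pmul
        (toArithmeticFunction (fun k : ℕ => χ (k : ZMod D)))) *
          (ArithmeticFunction.zeta : ArithmeticFunction ℂ)) (p ^ (k + 1)) = 1 - χ (p : ZMod D) := by
  have hp0 : p ≠ 0 := hp.ne_zero
  rw [← sum_divisors_moebius_chi_eq_AF, Nat.divisors_prime_pow hp, Finset.sum_map, Finset.sum_range_succ',
    Finset.sum_range_succ']
  have hzero : ∑ i ∈ Finset.range k,
      (ArithmeticFunction.moebius (p ^ (i + 1 + 1)) : ℂ) * χ ((p ^ (i + 1 + 1) : ℕ) : ZMod D) = 0 := by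
    refine Finset.sum_eq_zero fun i _ => ?_
    rw [ArithmeticFunction.moebius_apply_prime_pow hp (by omega), if_neg (by omega)]
    simp
  simp only [Function.Embedding.coeFn_mk, pow_zero, Nat.cast_one, ArithmeticFunction.moebius_apply_one,
    Int.cast_one, map_one, one_mul, zero_add, pow_one]
  rw [hzero, zero_add, ArithmeticFunction.moebius_apply_prime hp]
  push_cast
  ring

/-- **`Σ_{d∣n} μ(d)χ(d) = ∏_{p∣n}(1 − χ(p))`** for `n ≥ 1`. [cite: Zhang2022LandauSiegel, §3 p.6] -/
theorem sum_divisors_moebius_chi_eq_prod {n : ℕ} (hn : n ≠ 0) :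
    ∑ d ∈ n.divisors, (ArithmeticFunction.moebius d : ℂ) * χ (d : ZMod D) =
      ∏ p ∈ n.primeFactors, (1 - χ (p : ZMod D)) := by
  have hmult : ((((ArithmeticFunction.moebius : ArithmeticFunction ℂ).pmul
      (toArithmeticFunction (fun k : ℕ => χ (k : ZMod D)))) *
        (ArithmeticFunction.zeta : ArithmeticFunction ℂ))).IsMultiplicative :=
    (ArithmeticFunction.isMultiplicative_moebius.intCast.pmul (isMultiplicative_chiAF χ)).mul
      ArithmeticFunction.isMultiplicative_zeta.natCast
  rw [sum_divisors_moebius_chi_eq_AF, hmult.multiplicative_factorization _ hn, Finsupp.prod,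
    Nat.support_factorization]
  refine Finset.prod_congr rfl fun p hp => ?_
  have hp' : p.Prime := Nat.prime_of_mem_primeFactors hp
  have hk : n.factorization p ≠ 0 := by
    rw [← Finsupp.mem_support_iff, Nat.support_factorization]; exact hp
  obtain ⟨c, hc⟩ := Nat.exists_eq_succ_of_ne_zero hk
  rw [hc]
  exact moebiusChi_mul_zeta_prime_pow_succ χ hp' c

/-- `|ν⁻(n)| = ∏_{p∣n} |1 − χ(p)|` (`n ≥ 1`). [cite: Zhang2022LandauSiegel, §17 u021 p.98] -/
theorem norm_nuMinus_eq_prod {n : ℕ} (hn : n ≠ 0) :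
    ‖∑ d ∈ n.divisors, (ArithmeticFunction.moebius d : ℂ) * χ (d : ZMod D)‖ =
      ∏ p ∈ n.primeFactors, ‖1 - χ (p : ZMod D)‖ := by
  rw [sum_divisors_moebius_chi_eq_prod χ hn, norm_prod]

/-- **`|ν⁻(mn)| ≤ |ν⁻(m)|·2^{#primeFactors(n)}`** (`m, n ≥ 1`, no coprimality: `ν⁻` depends on the
radical only, and each prime of `n` not dividing `m` contributes `|1 − χ(p)| ≤ 2`).
[cite: Zhang2022LandauSiegel, §17 u021 p.98] -/
theorem norm_nuMinus_mul_le {m n : ℕ} (hm : m ≠ 0) (hn : n ≠ 0) :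
    ‖∑ d ∈ (m * n).divisors, (ArithmeticFunction.moebius d : ℂ) * χ (d : ZMod D)‖ ≤
      ‖∑ d ∈ m.divisors, (ArithmeticFunction.moebius d : ℂ) * χ (d : ZMod D)‖ *
        2 ^ n.primeFactors.card := by
  rw [norm_nuMinus_eq_prod χ (mul_ne_zero hm hn), norm_nuMinus_eq_prod χ hm, Nat.primeFactors_mul hm hn]
  have hsplit : m.primeFactors ∪ n.primeFactors = m.primeFactors ∪ (n.primeFactors \ m.primeFactors) := by
    rw [Finset.union_sdiff_self_eq_union]
  rw [hsplit, Finset.prod_union Finset.disjoint_sdiff]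
  refine mul_le_mul_of_nonneg_left ?_ (Finset.prod_nonneg fun _ _ => norm_nonneg _)
  calc ∏ p ∈ n.primeFactors \ m.primeFactors, ‖1 - χ (p : ZMod D)‖
      ≤ ∏ p ∈ n.primeFactors \ m.primeFactors, (2 : ℝ) := by
        refine Finset.prod_le_prod (fun _ _ => norm_nonneg _) fun p _ => ?_
        calc ‖1 - χ (p : ZMod D)‖ ≤ ‖(1 : ℂ)‖ + ‖χ (p : ZMod D)‖ := norm_sub_le _ _
          _ ≤ 1 + 1 := add_le_add (by simp) (χ.norm_le_one _)
          _ = 2 := by norm_num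
    _ = 2 ^ (n.primeFactors \ m.primeFactors).card := by rw [Finset.prod_const]
    _ ≤ 2 ^ n.primeFactors.card :=
        pow_le_pow_right₀ (by norm_num) (Finset.card_le_card Finset.sdiff_subset)

/-- The same with `2^{#primeFactors(n)} ≤ τ₂(n)`: `|ν⁻(mn)| ≤ |ν⁻(m)|·τ₂(n)`.
[cite: Zhang2022LandauSiegel, §17 u021 p.98] -/
theorem norm_nuMinus_mul_le_tau {m n : ℕ} (hm : m ≠ 0) (hn : n ≠ 0) :
    ‖∑ d ∈ (m * n).divisors, (ArithmeticFunction.moebius d : ℂ) * χ (d : ZMod D)‖ ≤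
      ‖∑ d ∈ m.divisors, (ArithmeticFunction.moebius d : ℂ) * χ (d : ZMod D)‖ * (n.divisors.card : ℝ) := by
  refine (norm_nuMinus_mul_le χ hm hn).trans (mul_le_mul_of_nonneg_left ?_ (norm_nonneg _))
  have h : 2 ^ n.primeFactors.card ≤ n.divisors.card := by
    rw [Nat.card_divisors hn]
    refine Finset.pow_card_le_prod _ _ _ fun p hp => ?_
    have : 0 < n.factorization p := Nat.Prime.factorization_pos_of_dvd (Nat.prime_of_mem_primeFactors hp)
      hn (Nat.dvd_of_mem_primeFactors hp)
    omega
  exact_mod_cast h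

end Literature.NumberTheory.LFunctions.Zhang2022.Phi3Eval
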